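import Mathlib
import HarnessLib
import Literature.Computability.AlgebraicComplexity.PatternExpressions
import Summits.ValiantsHypothesis.ValiantsHypothesis.Theorems.MonotoneRestorationOrbitCompressionQPMultiRowStratum

/-!
# Route MonotoneRestoration — aside `OrbitCompressionQP` (stmt-ValiantsHypothesis-18332), line
# `expression_compression`: the `k`-row stratum from an OPEN-LABEL VALUE — the expression-language socket

`…MultiRowSocket.lean` states the `k`-row stratum in the shape a representation
`g_n = Q_n(p_{α_1}, …, p_{α_m})` in polarised power sums plugs into.  The stratum needs less: it suffices
that `g_n(rows ρ)` be the VALUE of one `(k,l)`-label pattern expression of quasi-polynomial length at the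
row assignment `ρ` (all column structure bound inside; `k`, `l` fixed).  This file records that socket —
the exact expression-language form of the open `k`-row representation problem ("vector-symmetric
Bläser–Jindal"): every column-symmetric `VP` family `g_n ∈ ℂ[x_{a,v} : a < k, v < n]^{S_n}` should be the
open value of a narrow short expression.  Power-sum representations (`…MultiRowStratum`), column gadgets
under symmetric `VQP` functions (`…MultiRowGadget`) and products/sums of such are instances.

* `exists_sumRows_kl` — summing out all `k` row labels of a `(k,l)`-expression whose value does not
  depend on the column labels (`…MultiRowStratum.exists_sumRows` is `l = 1`);
* ★ `narrowQP_multiRow_of_openValue` — if `(V_n)` are `(k,l)`-expressions of quasi-polynomial length with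
  `V_n.value ρ γ = g_n ρ` then `f_n = Σ_{ρ : [k] → [n]} g_n ρ` satisfies the conclusion of
  `stub_narrowExpressionCompression` (with `(k,l)` labels).

Helper file (`--supports stmt-ValiantsHypothesis-18332`); def-free; nothing here is a named fact; no registered
stub is closed; VP ≠ VNP is not moved.
-/

noncomputable section

open MvPolynomial

-- `Summit.ValiantsHypothesis.ValiantsHypothesis.…` is the tree's single-conjunct layout (Sub = Summit).
set_option linter.dupNamespace false

namespace Summit.ValiantsHypothesis.ValiantsHypothesis.Theorems

namespace FormulaSubstitution

open Literature.Computability.AlgebraicComplexity OrbitRestorationQPHomPolyClose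

section SingleLevel

variable {F : Type} [CommSemiring F] {k l : ℕ}

/-- Summing out ALL `k` row labels of a `(k,l)`-expression whose value does not depend on the column
labels: value `Σ_{ρ'} G ρ'` at every assignment, length `|e| + k`. [folklore] -/
theorem exists_sumRows_kl {n : ℕ} (e : PatternExpr F k l)
    (G : (Fin k → Fin n) → MvPolynomial (Fin n × Fin n) F)
    (hG : ∀ (ρ : Fin k → Fin n) (γ : Fin l → Fin n), e.value n ρ γ = G ρ) :
    ∃ e' : PatternExpr F k l, e'.length = e.length + k ∧
      ∀ (ρ : Fin k → Fin n) (γ : Fin l → Fin n), e'.value n ρ γ = ∑ ρ' : Fin k → Fin n, G ρ' := by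
  classical
  refine ⟨(List.finRange k).foldr PatternExpr.sumRow e,
    by rw [NarrowClosure.length_foldr_sumRow, List.length_finRange], fun ρ γ => ?_⟩
  rw [value_foldr_sumRow n e γ (List.finRange k) (List.nodup_finRange k) ρ]
  have hk : Finset.univ.filter (fun ρ' : Fin k → Fin n => ∀ a, a ∉ List.finRange k → ρ' a = ρ a)
      = Finset.univ :=
    Finset.filter_true_of_mem fun ρ' _ a ha => absurd (List.mem_finRange a) ha
  rw [hk]
  exact Finset.sum_congr rfl fun ρ' _ => hG ρ' γ

end SingleLevel

section Strata

/-- ★ **The `k`-row stratum from an open-label value.**  Let `g_n ρ ∈ ℂ[x_ij]` (`ρ : [k] → [n]`) be the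
value of a `(k,l)`-label pattern expression `V_n` of quasi-polynomial length at the row assignment `ρ`
(independently of the column assignment).  Then `f_n = Σ_{ρ : [k] → [n]} g_n ρ` satisfies the conclusion of
`stub_narrowExpressionCompression` with `(k,l)` labels.  This is the socket of the `k`-row stratum in the
expression language: the open problem for `k ≥ 2` is to produce such `V_n` for `g_n ρ = g_n(rows ρ)`,
`g_n` a column-symmetric `VP` family. [folklore] -/
theorem narrowQP_multiRow_of_openValue (k l : ℕ)
    (g : (n : ℕ) → (Fin k → Fin n) → MvPolynomial (Fin n × Fin n) ℂ)
    (V : ℕ → PatternExpr ℂ k l)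
    (hV : ∃ c : ℕ, ∀ n : ℕ, 1 ≤ n → (V n).length ≤ 2 ^ ((Nat.log 2 n + c) ^ c) ∧
      ∀ (ρ : Fin k → Fin n) (γ : Fin l → Fin n), (V n).value n ρ γ = g n ρ) :
    ∃ c : ℕ, ∀ n : ℕ, 1 ≤ n → ∃ (k' l' : ℕ) (e : PatternExpr ℂ k' l'),
      n ^ (k' + l') ≤ 2 ^ ((Nat.log 2 n + c) ^ c) ∧ e.length ≤ 2 ^ ((Nat.log 2 n + c) ^ c) ∧
      e.close n = ∑ ρ : Fin k → Fin n, g n ρ := by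
  classical
  obtain ⟨c₁, hc₁⟩ := hV
  obtain ⟨c₂, hc₂⟩ := NarrowClosure.qp_combine c₁ (k + 1)
  refine ⟨max c₂ (k + l + 1), fun n hn => ?_⟩
  obtain ⟨hl, hv⟩ := hc₁ n hn
  obtain ⟨e₁, hl₁, hv₁⟩ := exists_sumRows_kl (V n) (g n) hv
  obtain ⟨e₂, hl₂, hc₂'⟩ := exists_close_eq_of_value_const_kl hn e₁ _ hv₁
  refine ⟨k, l, e₂, ?_, ?_, hc₂'⟩
  · calc n ^ (k + l) ≤ n ^ (k + l) + (k + l) := Nat.le_add_right _ _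
      _ ≤ 2 ^ ((Nat.log 2 n + (k + l + 1)) ^ (k + l + 1)) := CompressionFloors.pbounded_le_qp n (k + l)
      _ ≤ 2 ^ ((Nat.log 2 n + max c₂ (k + l + 1)) ^ max c₂ (k + l + 1)) :=
          Nat.pow_le_pow_right (by norm_num) (CompressionFloors.polylog_mono (le_max_right _ _))
  · have hk : n ^ k + k ≤ 2 ^ ((Nat.log 2 n + (k + 1)) ^ (k + 1)) := CompressionFloors.pbounded_le_qp n k
    have h2 := hc₂ (Nat.log 2 n) (V n).length (n ^ k + k) hl hk
    have hk1 : k ≤ n ^ k + k := Nat.le_add_left _ _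
    calc e₂.length = (V n).length + k + 2 := by rw [hl₂, hl₁]
      _ ≤ ((V n).length + 2) * (n ^ k + k + 2) := by nlinarith
      _ ≤ 2 ^ ((Nat.log 2 n + c₂) ^ c₂) := h2
      _ ≤ 2 ^ ((Nat.log 2 n + max c₂ (k + l + 1)) ^ max c₂ (k + l + 1)) :=
          Nat.pow_le_pow_right (by norm_num) (CompressionFloors.polylog_mono (le_max_left _ _))

/-- **The socket applied to row substitutions.**  If `(V_n)` are `(k,l)`-expressions of quasi-polynomial
length whose value at `ρ` is `g_n` with its rows substituted by `ρ` (`x_{a,v} ↦ x_{ρ a, v}`), then the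
`k`-row family `f_n = Σ_ρ g_n(rows ρ)` — the shape of `…MultiRowSocket.narrowQP_multiRow_of_representation`'s
conclusion — satisfies the conclusion of `stub_narrowExpressionCompression`. [folklore] -/
theorem narrowQP_multiRow_of_openValue_rows (k l : ℕ)
    (g : (n : ℕ) → MvPolynomial (Fin k × Fin n) ℂ)
    (V : ℕ → PatternExpr ℂ k l)
    (hV : ∃ c : ℕ, ∀ n : ℕ, 1 ≤ n → (V n).length ≤ 2 ^ ((Nat.log 2 n + c) ^ c) ∧
      ∀ (ρ : Fin k → Fin n) (γ : Fin l → Fin n), (V n).value n ρ γ =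
        aeval (fun av : Fin k × Fin n => (X (ρ av.1, av.2) : MvPolynomial (Fin n × Fin n) ℂ)) (g n)) :
    ∃ c : ℕ, ∀ n : ℕ, 1 ≤ n → ∃ (k' l' : ℕ) (e : PatternExpr ℂ k' l'),
      n ^ (k' + l') ≤ 2 ^ ((Nat.log 2 n + c) ^ c) ∧ e.length ≤ 2 ^ ((Nat.log 2 n + c) ^ c) ∧
      e.close n = ∑ ρ : Fin k → Fin n,
        aeval (fun av : Fin k × Fin n => (X (ρ av.1, av.2) : MvPolynomial (Fin n × Fin n) ℂ)) (g n) :=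
  narrowQP_multiRow_of_openValue k l
    (fun n ρ => aeval (fun av : Fin k × Fin n =>
      (X (ρ av.1, av.2) : MvPolynomial (Fin n × Fin n) ℂ)) (g n)) V hV

end Strata

end FormulaSubstitution

end Summit.ValiantsHypothesis.ValiantsHypothesis.Theorems

end
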